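import Summits.QuantumFields.BalabanUV.Beta.AccretiveCombesThomasBudget

/-!
# NODE O port PT-A — `stub_G3C` helper (repaired road, leaf (γ)): COMBES–THOMAS FROM COERCIVITY + A LATTICE-WEIGHTED SCHUR BOUND — the entrywise decay
# `‖A⁻¹ i j‖ ≤ (2/γ)·e^{−κ·d(i,j)}` of the inverse of a `Re`-coercive complex kernel whose row AND column sums WEIGHTED BY `e^{δ₁·d}` are `≤ c` (the shape of the
# hand's (P4-lat) `P0CarrierLatticeDecay`), at every rate `κ ≤ δ₁/2` with `4κc ≤ γδ₁`

Cell `ym-nodeO-ideate`, porter hand `hand-27930-G3C` (g0); proof kind, `--supports stmt-QuantumFields-27930 --as helper` (count-neutral).  [B9] = [Balaban1985BackgroundPropagators],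
[16] = [Balaban1985UV3], [B4] = [Balaban1983RegularityDecay].

WHY.  The hand's verdict on `stub_G3C` (`G3C-OBSTRUCTION-v1.md`, crux `Lines/pta_residueW-stub_G3C-hand.md`): the generalized random walk expansion of `Tr (x + T)⁻¹` ([16] (23)–(25) p.262,
[B9] (3.87)–(3.94)) needs the carrier's decay at the UNIT-LATTICE scale — typed as (P4-lat) `P0CarrierLatticeDecay`: `Σ_j ‖T i j‖·e^{δ₁·tdist(i,j)} ≤ c` for rows and columns.  Its first use
on the repaired road is the lattice-scale localisation of the local inverses `G_□ = (x + T^{(□̃)})⁻¹` ([B9] (3.42) p.399 «|G′(y,y′)| ≤ O(1)e^{−δ₀|y−y′|}»), which is exactly this file's theorem: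
the tree's ACCRETIVE Combes–Thomas (✓`Beta.AccretiveCombesThomas.norm_inv_apply_le`: conjugated coercivity ⟹ entry decay) fed by the tree's Schur budget of the conjugation defect
(✓`Beta.AccretiveCombesThomasBudget.conjLower_of_expDefect`) and a NEW elementary bound of the exponential defect by the weighted Schur sums (`expRowDefect_le_of_weightedSchur`,
`expColDefect_le_of_weightedSchur`, from `e^{κt} − 1 ≤ (2κ/δ₁)·e^{δ₁t}` for `2κ ≤ δ₁`).  Generic over a finite index type and a pseudo-metric `d` (symmetric, triangle inequality, `d(j,j) = 0`);
at the record `d = Site.tdist` on the level-`k` torus.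

WHAT THIS FILE PROVES (sorry-free): `exp_mul_sub_one_le` · `expRowDefect_le_of_weightedSchur` · `expColDefect_le_of_weightedSchur` · `conjCoercive_of_weightedSchur` (coercivity `γ` + weighted Schur
`c` at rate `δ₁` ⟹ conjugated coercivity `γ/2` along every `d`-Lipschitz weight at every rate `κ`, `0 ≤ κ`, `2κ ≤ δ₁`, `4κc ≤ γδ₁`) · ★ `norm_inv_apply_le_of_weightedSchur` (`‖A⁻¹ i j‖ ≤ e^{−κ·d(i,j)}/(γ/2)`)
· `isUnit_of_weightedSchur_coercive` (bookkeeping: `IsUnit A`).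

HONEST FRAMING.  Elementary finite-dimensional linear algebra (Combes–Thomas ∕ Agmon), assembled from the tree's accretive kit; nothing of Bałaban's asserted, ported or discharged; `stub_G3C`
NOT closed (mis-cut verdict stands; this serves the REPAIRED letter `G3CAtRecordL`); 27930 OPEN; NODE O 0∕1; COUNT 8∕28 · K 1∕4 UNMOVED; finite `𝕋⁴` at fixed ε — NOT continuum ∕ OS ∕ Clay;
**the Yang–Mills mass gap is NOT proved by any of this.**  No `sorry`, no `instance`, no `notation`, no `def`; standard axioms.
-/

noncomputable section

open scoped BigOperators Matrix ComplexConjugate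
open Finset Complex Matrix

namespace Summit.QuantumFields.YangMills.Theorems.BalabanUVNodesPortS1.G3CCT

open Summit.QuantumFields.BalabanUV.Beta.AccretiveCombesThomas
open Summit.QuantumFields.BalabanUV.Beta.AccretiveCombesThomasBudget
open Literature.MathematicalPhysics.QuantumFieldTheory.Balaban1983to89.B5Prop11Lower (nsq nsq_nonneg)

variable {ι : Type*} [Fintype ι]

/-- **Elementary**: `e^{κt} − 1 ≤ (2κ/δ₁)·e^{δ₁t}` for `0 ≤ κ`, `2κ ≤ δ₁`, `0 < δ₁`, `0 ≤ t` (from `1 − x ≤ e^{−x}` and `x + 1 ≤ e^{x}`). [folklore] -/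
theorem exp_mul_sub_one_le {κ δ₁ t : ℝ} (hκ : 0 ≤ κ) (hκδ : 2 * κ ≤ δ₁) (hδ₁ : 0 < δ₁) (ht : 0 ≤ t) :
    Real.exp (κ * t) - 1 ≤ 2 * κ / δ₁ * Real.exp (δ₁ * t) := by
  -- e^{κt} − 1 = e^{κt}(1 − e^{−κt}) ≤ e^{κt}·κt
  have h1 : Real.exp (κ * t) - 1 ≤ Real.exp (κ * t) * (κ * t) := by
    have h := Real.one_sub_le_exp_neg (κ * t)
    have hpos := Real.exp_pos (κ * t)
    have e : Real.exp (κ * t) * Real.exp (-(κ * t)) = 1 := by rw [← Real.exp_add, add_neg_cancel, Real.exp_zero]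
    nlinarith [mul_le_mul_of_nonneg_left h hpos.le]
  -- e^{κt} ≤ e^{δ₁t/2} and t ≤ (2/δ₁)e^{δ₁t/2}
  have h2 : Real.exp (κ * t) ≤ Real.exp (δ₁ / 2 * t) := Real.exp_le_exp.2 (by nlinarith)
  have h3 : t ≤ 2 / δ₁ * Real.exp (δ₁ / 2 * t) := by
    have h := Real.add_one_le_exp (δ₁ / 2 * t)
    rw [div_mul_eq_mul_div, le_div_iff₀ hδ₁]
    nlinarith [Real.exp_pos (δ₁ / 2 * t)]
  have h4 : Real.exp (δ₁ / 2 * t) * Real.exp (δ₁ / 2 * t) = Real.exp (δ₁ * t) := by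
    rw [← Real.exp_add]; ring_nf
  calc Real.exp (κ * t) - 1 ≤ Real.exp (κ * t) * (κ * t) := h1
    _ ≤ Real.exp (δ₁ / 2 * t) * (κ * (2 / δ₁ * Real.exp (δ₁ / 2 * t))) := by
        apply mul_le_mul h2 (mul_le_mul_of_nonneg_left h3 hκ) (by positivity) (by positivity)
    _ = 2 * κ / δ₁ * Real.exp (δ₁ * t) := by rw [← h4]; ring

omit [Fintype ι] in
/-- The exponential pair weight along a `d`-Lipschitz weight is at most `(2κ/δ₁)·e^{δ₁·d(e,e′)}`. [folklore] -/
theorem expWeight_le_of_lipschitz {κ δ₁ : ℝ} (hκ : 0 ≤ κ) (hκδ : 2 * κ ≤ δ₁) (hδ₁ : 0 < δ₁) {ρ : ι → ℝ} {d : ι → ι → ℝ}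
    (hd : ∀ e e', 0 ≤ d e e') (hρ : ∀ e e', |ρ e - ρ e'| ≤ d e e') (e e' : ι) :
    expWeight κ ρ e e' ≤ 2 * κ / δ₁ * Real.exp (δ₁ * d e e') :=
  (expWeight_le_of_abs_sub_le hκ (hρ e e')).trans (exp_mul_sub_one_le hκ hκδ hδ₁ (hd e e'))

/-- **Row defect from a weighted Schur ROW bound**: `Σ_{e′} ‖R e e′‖·e^{δ₁ d(e,e′)} ≤ c` ⟹ `expRowDefect R κ ρ e ≤ (2κ/δ₁)·c`. [folklore] -/
theorem expRowDefect_le_of_weightedSchur (R : Matrix ι ι ℂ) {κ δ₁ c : ℝ} (hκ : 0 ≤ κ) (hκδ : 2 * κ ≤ δ₁) (hδ₁ : 0 < δ₁)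
    (ρ : ι → ℝ) (d : ι → ι → ℝ) (hd : ∀ e e', 0 ≤ d e e') (hρ : ∀ e e', |ρ e - ρ e'| ≤ d e e')
    (hR : ∀ e, ∑ e', ‖R e e'‖ * Real.exp (δ₁ * d e e') ≤ c) (e : ι) :
    expRowDefect R κ ρ e ≤ 2 * κ / δ₁ * c := by
  have hk : 0 ≤ 2 * κ / δ₁ := by positivity
  calc expRowDefect R κ ρ e = ∑ e', ‖R e e'‖ * expWeight κ ρ e e' := rfl
    _ ≤ ∑ e', ‖R e e'‖ * (2 * κ / δ₁ * Real.exp (δ₁ * d e e')) :=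
        Finset.sum_le_sum fun e' _ => mul_le_mul_of_nonneg_left (expWeight_le_of_lipschitz hκ hκδ hδ₁ hd hρ e e') (norm_nonneg _)
    _ = 2 * κ / δ₁ * ∑ e', ‖R e e'‖ * Real.exp (δ₁ * d e e') := by
        rw [Finset.mul_sum]; exact Finset.sum_congr rfl fun e' _ => by ring
    _ ≤ 2 * κ / δ₁ * c := mul_le_mul_of_nonneg_left (hR e) hk

/-- **Column defect from a weighted Schur COLUMN bound**: `Σ_{e} ‖R e e′‖·e^{δ₁ d(e,e′)} ≤ c` ⟹ `expColDefect R κ ρ e′ ≤ (2κ/δ₁)·c`. [folklore] -/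
theorem expColDefect_le_of_weightedSchur (R : Matrix ι ι ℂ) {κ δ₁ c : ℝ} (hκ : 0 ≤ κ) (hκδ : 2 * κ ≤ δ₁) (hδ₁ : 0 < δ₁)
    (ρ : ι → ℝ) (d : ι → ι → ℝ) (hd : ∀ e e', 0 ≤ d e e') (hρ : ∀ e e', |ρ e - ρ e'| ≤ d e e')
    (hC : ∀ e', ∑ e, ‖R e e'‖ * Real.exp (δ₁ * d e e') ≤ c) (e' : ι) :
    expColDefect R κ ρ e' ≤ 2 * κ / δ₁ * c := by
  have hk : 0 ≤ 2 * κ / δ₁ := by positivity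
  calc expColDefect R κ ρ e' = ∑ e, ‖R e e'‖ * expWeight κ ρ e e' := rfl
    _ ≤ ∑ e, ‖R e e'‖ * (2 * κ / δ₁ * Real.exp (δ₁ * d e e')) :=
        Finset.sum_le_sum fun e _ => mul_le_mul_of_nonneg_left (expWeight_le_of_lipschitz hκ hκδ hδ₁ hd hρ e e') (norm_nonneg _)
    _ = 2 * κ / δ₁ * ∑ e, ‖R e e'‖ * Real.exp (δ₁ * d e e') := by
        rw [Finset.mul_sum]; exact Finset.sum_congr rfl fun e _ => by ring
    _ ≤ 2 * κ / δ₁ * c := mul_le_mul_of_nonneg_left (hC e') hk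

omit [Fintype ι] in
/-- The column weight `ρ = d(·, j)` of a symmetric pseudo-metric is `d`-Lipschitz. [folklore] -/
theorem abs_sub_col_le (d : ι → ι → ℝ) (hsymm : ∀ i j, d i j = d j i) (htri : ∀ i j l, d i l ≤ d i j + d j l) (j e e' : ι) :
    |d e j - d e' j| ≤ d e e' := by
  rw [abs_sub_le_iff]
  constructor
  · have := htri e e' j; linarith
  · have := htri e' e j; rw [hsymm e' e] at this; linarith

/-- **CONJUGATED COERCIVITY from coercivity + weighted Schur**: `γ‖z‖² ≤ Re z^*Az`, weighted row∕column sums `≤ c` at rate `δ₁`, and a rate `κ` with `0 ≤ κ`, `2κ ≤ δ₁`, `4κc ≤ γδ₁` ⟹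
`(γ/2)‖z‖² ≤ Re conjForm A κ ρ z` along every `d`-Lipschitz weight `ρ`. [folklore] -/
theorem conjCoercive_of_weightedSchur (A : Matrix ι ι ℂ) (d : ι → ι → ℝ) (hd : ∀ i j, 0 ≤ d i j)
    {γ c δ₁ κ : ℝ} (hδ₁ : 0 < δ₁) (hκ : 0 ≤ κ) (hκδ : 2 * κ ≤ δ₁) (hκc : 4 * κ * c ≤ γ * δ₁)
    (hcoer : ∀ z : ι → ℂ, γ * nsq z ≤ (star z ⬝ᵥ (A *ᵥ z)).re)
    (hrow : ∀ i, ∑ j, ‖A i j‖ * Real.exp (δ₁ * d i j) ≤ c) (hcol : ∀ j, ∑ i, ‖A i j‖ * Real.exp (δ₁ * d i j) ≤ c)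
    {ρ : ι → ℝ} (hρ : ∀ e e', |ρ e - ρ e'| ≤ d e e') (z : ι → ℂ) :
    γ / 2 * nsq z ≤ (conjForm A κ ρ z).re := by
  have hJr := expRowDefect_le_of_weightedSchur A hκ hκδ hδ₁ ρ d hd hρ hrow
  have hJc := expColDefect_le_of_weightedSchur A hκ hκδ hδ₁ ρ d hd hρ hcol
  have hlow := conjCoercive_of_conjLower hcoer (conjLower_of_expDefect A κ ρ hJr hJc) z
  have hJ : (2 * κ / δ₁ * c + 2 * κ / δ₁ * c) / 2 = 2 * κ * c / δ₁ := by ring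
  rw [hJ] at hlow
  have hbud : 2 * κ * c / δ₁ ≤ γ / 2 := by
    rw [div_le_iff₀ hδ₁]; linarith
  nlinarith [nsq_nonneg z]

/-- ★ **COMBES–THOMAS FROM COERCIVITY + WEIGHTED SCHUR** ([B9] (3.42)-type localisation of local inverses, abstractly): for a `Re`-coercive (`γ > 0`) complex kernel `A` on a finite index set
with a symmetric pseudo-metric `d` (`d(j,j) = 0`, triangle inequality) whose `e^{δ₁d}`-weighted row and column sums are `≤ c`, every rate `κ` with `0 ≤ κ`, `2κ ≤ δ₁`, `4κc ≤ γδ₁` gives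
`‖A⁻¹ i j‖ ≤ e^{−κ·d(i,j)}/(γ/2)`. [cite: Balaban1985BackgroundPropagators, (3.42) p.399; Balaban1983RegularityDecay, (5.7) p.594] -/
theorem norm_inv_apply_le_of_weightedSchur [DecidableEq ι] (A : Matrix ι ι ℂ) (d : ι → ι → ℝ) (hd0 : ∀ j, d j j = 0)
    (hd : ∀ i j, 0 ≤ d i j) (hsymm : ∀ i j, d i j = d j i) (htri : ∀ i j l, d i l ≤ d i j + d j l)
    {γ c δ₁ κ : ℝ} (hγ : 0 < γ) (hδ₁ : 0 < δ₁) (hκ : 0 ≤ κ) (hκδ : 2 * κ ≤ δ₁) (hκc : 4 * κ * c ≤ γ * δ₁)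
    (hcoer : ∀ z : ι → ℂ, γ * nsq z ≤ (star z ⬝ᵥ (A *ᵥ z)).re)
    (hrow : ∀ i, ∑ j, ‖A i j‖ * Real.exp (δ₁ * d i j) ≤ c) (hcol : ∀ j, ∑ i, ‖A i j‖ * Real.exp (δ₁ * d i j) ≤ c)
    (i j : ι) :
    ‖A⁻¹ i j‖ ≤ Real.exp (-(κ * d i j)) / (γ / 2) :=
  norm_inv_apply_le A d hd0 hκ (half_pos hγ)
    (fun j' z => conjCoercive_of_weightedSchur A d hd hδ₁ hκ hκδ hκc hcoer hrow hcol (abs_sub_col_le d hsymm htri j') z) i j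

/-- Bookkeeping: such an `A` is a unit (coercivity alone). [folklore] -/
theorem isUnit_of_weightedSchur_coercive [DecidableEq ι] (A : Matrix ι ι ℂ) {γ : ℝ} (hγ : 0 < γ)
    (hcoer : ∀ z : ι → ℂ, γ * nsq z ≤ (star z ⬝ᵥ (A *ᵥ z)).re) : IsUnit A :=
  isUnit_of_reCoercive hγ hcoer

end Summit.QuantumFields.YangMills.Theorems.BalabanUVNodesPortS1.G3CCT

end
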